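import Literature.MathematicalPhysics.QuantumLattice.GriffithsSimonApproximation
import Literature.Probability.LatticeModels.GaussianPairingBoundCouplings
import Literature.Probability.LatticeModels.IsingTorusTransfer
import HarnessLib

/-!
# Newman's Gaussian inequality for lattice `φ⁴` measures (via the block Ising approximation)

Proofs-only file (topic `Literature/MathematicalPhysics/QuantumLattice`; theorems only, no definition,
no named fact). Second step of the `φ⁴` line of Aizenman–Duminil-Copin 2021 in the tree's vocabulary,
after `GriffithsSimonApproximation.lean`: §7, p. 28 — "we identify `⟨·⟩_{ρ,β}` with the Ising
measure, and `τₓ` with the proper average of Ising's variables. With this identification, we can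
harvest all the nice inequalities that are given by Ising's theory" — carried out for the finite-`N`
block approximants of `exists_blockIsing_tendsto_integral_phi4Measure`, and used to move ONE Ising
inequality to the lattice `φ⁴` measure `phi4Measure G g κ J` of `LatticeScalarField.lean`: the
Gaussian (Newman–Aizenman) inequality — the lower half `S_{2n} ≤ 𝒢_n[S]` of ADC's (6.3), §6.3,
p. 26, the inequality through which Prop. 1.4 / Prop. 7.2 are proved — in its site form, in Newman's
smeared even-moment form, and summed to Gaussian domination of the exponential moments.

## Contents (all proved)

* Dictionary (`V × Fin n`): `spinAt_blockCfg`, `sum_blockCfg` (block Boolean configurations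
  `s : V → Fin n → Bool` ↔ spin configurations on `V × Fin n`), `weightedMagnetization_blockCfg`,
  `mul_pairInteraction_eq_half_sum_adj` (weighted handshake), **`blockEnergy_eq_sum_coupling`**
  (the block Boltzmann exponent `∑ₓ ∑ᵢⱼ Kᵢⱼ s_{x,i}s_{x,j} + J ∑_{xy ∈ E(G)} τₓτ_y` is the pair
  interaction with ordered-pair couplings `c_{(x,i),(y,j)} = [x = y] Kᵢⱼ + [x ∼ y] (J/2) wᵢwⱼ`),
  **`blockGibbsSum_eq_avg`** and **`integral_latticeFieldMeasure_isingMagnetizationLaw_eq_avg`**: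
  expectations under `latticeFieldMeasure G (isingMagnetizationLaw n K w) J` are the Gibbs averages
  `PairIsing.avg c` of `GaussianPairingBoundCouplings.lean` on the finite set `V × Fin n`, so that
  everything proved there for `PairIsing.avg` (GKS via `avg_eq_gksExpect`, GHS, Newman's Gaussian
  inequality `avg_spinMonomial_le_pairingSum` / `avg_pow_two_mul_le`) applies to the approximants;
  `blockCoupling_nonneg` (`c ≥ 0` for `K, w, J ≥ 0`).
* **`blockIsing_integral_pow_le`**: `⟨X^{2m}⟩ ≤ (2m)!/(2^m m!) ⟨X²⟩^m` for `X = ∑ₓ aₓ φₓ`, `a ≥ 0`,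
  under the block-Ising lattice laws (`PairIsing.avg_pow_two_mul_le` on `V × Fin n`).
* **`phi4_integral_pow_le`**: the same for `phi4Measure G g κ J` (`g > 0`, `J ≥ 0`, `a ≥ 0`), by
  `exists_blockIsing_tendsto_integral_phi4Measure` and passage to the limit (`abs_pow_sum_mul_le`
  puts even powers of smeared fields in the admissible growth class).
* Exponential moments: `spinAt_neg`, `pairIsingWeight_neg`, `pairIsingAvg_eq_zero_of_odd` (spin
  flip: odd observables average to zero at zero field), **`pairIsingAvg_exp_mul_le`**
  (`⟨e^{tX}⟩ ≤ e^{t²⟨X²⟩/2}` for pair-interaction Ising models, by summing Newman's inequality over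
  the exponential series) and **`phi4_integral_exp_mul_le`**: for `g > 0`, `J ≥ 0`, `a ≥ 0` and
  all real `t`, `∫ e^{t ∑ aₓφₓ} d(phi4Measure G g κ J) ≤ exp(t² ∫ (∑ aₓφₓ)² d(phi4Measure G g κ J) / 2)`
  — the a-priori bound turning uniform second-moment bounds into uniform exponential integrability
  of smeared lattice `φ⁴` fields.

* Site form: `prod_eq_prod_pairIdx`, `sum_prod_mul_prod_pairs_eq`, **`sum_prod_mul_pairingSum_eq`**
  (multilinearity of the Gaussian pairing functional `pairingSum` in the points: smearing
  `𝒢_n[S]` over the constituent indices with weights `∏ w_{Lᵢ}` gives `𝒢_n` of the smeared two-point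
  function), **`blockIsing_integral_prod_le_pairingSum`** and **`phi4_integral_prod_le_pairingSum`**:
  `⟨φ_{x₁} ⋯ φ_{x_{2m}}⟩ ≤ 𝒢_m[⟨φφ⟩](x)` under `phi4Measure G g κ J` (`g > 0`, `J ≥ 0`) — the lower
  half `S_{2n} ≤ 𝒢_n[S]` of ADC (6.3) for lattice `φ⁴`; `m = 2` is Lebowitz' `U₄ ≤ 0`
  (`abs_prod_apply_le` is the growth bound for field monomials).

## What is NOT here

The upper half of ADC (6.3) (the `U₄` correction: random currents on the block graph), signed
weights `a` in the smeared statements, and any infinite-volume statement.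

## Sources

* M. Aizenman, H. Duminil-Copin, Ann. Math. 194 (2021), arXiv:1912.07973: §2 (p. 7, block spins on
  `𝒱 × 𝒦_N`), §6.3 eq. (6.3) (p. 26), §7 first paragraphs (p. 28). [AizenmanDuminilCopinAnnals2021]
* C. M. Newman, *Inequalities for Ising models and field theories which obey the Lee–Yang theorem*,
  Comm. Math. Phys. 41 (1975) 1–9, Theorem 5, eq. (2.8) — as vendored (and proved for pair-interaction
  Ising systems) in `GaussianPairingBoundCouplings.lean`. [Newman1975]
* B. Simon, R. B. Griffiths, Comm. Math. Phys. 33 (1973) 145–164 (the approximation). [SimonGriffiths1973]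

## Tree / Mathlib anchors

`integral_latticeFieldMeasure_isingMagnetizationLaw`, `exists_blockIsing_tendsto_integral_phi4Measure`
(`GriffithsSimonApproximation`); `PairIsing.avg`, `PairIsing.weight`, `PairIsing.avg_pow_two_mul_le`
(`GaussianPairingBoundCouplings`); `sum_edgeFinset_eq_half_sum_neighborFinset` (`IsingTorusTransfer`);
`spinAt`, `SpinConfig`, `spinVal`, `weightedMagnetization`, `isingPairEnergy`; Mathlib
`Fintype.sum_bijective`, `Fintype.sum_prod_type`, `Finset.sum_mul_sq_le_sq_mul_sq`,
`Real.pow_div_factorial_le_exp`, `NormedSpace.expSeries_div_hasSum_exp`, `HasSum.even_add_odd`,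
`hasSum_le`, `le_of_tendsto_of_tendsto`.

## Design

No declaration is introduced for the encoding or the block coupling matrix: both are written out in
the statements (as in `IsingLimitLawProofs.spinAt_boolCfg`), so the file is theorems-only.
-/

noncomputable section

open MeasureTheory Filter Topology Finset

namespace Literature.MathematicalPhysics.QuantumLattice

open Literature.Probability.LatticeModels

/-! ### The block Ising approximants as pair-interaction Ising models on `V × Fin n`

Throughout, a block Boolean configuration `s : V → Fin n → Bool` is encoded as the `ℤˣ`-valued spin
configuration `fun b : V × Fin n => if s b.1 b.2 then 1 else -1` on `V × Fin n` (`true ↦ 1`,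
`false ↦ -1`, the tree's encoding `spinAt_boolCfg` of `IsingLimitLawProofs`), and the block system
with intra-block couplings `K`, block weights `w` and edge coupling `J` has the ordered-pair
coupling matrix `c_{(x,i),(y,j)} = [x = y] K_{ij} + [x ∼ y] (J/2) wᵢ wⱼ` (each edge of `G` is an
ordered pair twice, whence `J/2`); both are written out in the statements (no declaration). -/

section Dictionary

variable {V : Type*} [Fintype V] [DecidableEq V] (G : SimpleGraph V) [DecidableRel G.Adj] {n : ℕ}

omit [Fintype V] [DecidableEq V] in
/-- Under the encoding, `spinAt (x,i)` is `spinVal (s x) i`. [folklore] -/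
theorem spinAt_blockCfg (s : V → Fin n → Bool) (a : V × Fin n) :
    spinAt a (fun b : V × Fin n => if s b.1 b.2 then (1 : ℤˣ) else -1) = spinVal (s a.1) a.2 := by
  simp only [spinAt, spinVal]
  cases s a.1 a.2 <;> simp

/-- Sums over block Boolean configurations are sums over spin configurations on `V × Fin n` (the
encoding is a bijection). [folklore] -/
theorem sum_blockCfg (Φ : SpinConfig (V × Fin n) → ℝ) :
    ∑ s : V → Fin n → Bool, Φ (fun b : V × Fin n => if s b.1 b.2 then (1 : ℤˣ) else -1) =
      ∑ ρ, Φ ρ := by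
  classical
  have hne : (-1 : ℤˣ) ≠ 1 := by decide
  refine Fintype.sum_bijective
    (fun (s : V → Fin n → Bool) (b : V × Fin n) => if s b.1 b.2 then (1 : ℤˣ) else -1)
    ⟨fun s t hst => ?_, fun ρ => ⟨fun x i => decide (ρ (x, i) = 1), ?_⟩⟩ _ _ fun _ => rfl
  · funext x i
    have hi := congr_fun hst (x, i)
    simp only at hi
    revert hi
    cases s x i <;> cases t x i <;> simp [hne, hne.symm]
  · funext b
    rcases Int.units_eq_one_or (ρ b) with h | h <;> simp [h, hne]

omit [Fintype V] [DecidableEq V] in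
/-- The block variable is the weighted magnetization of the block: `τₓ(s) = ∑ᵢ wᵢ σ_{(x,i)}`.
[folklore] -/
theorem weightedMagnetization_blockCfg (w : Fin n → ℝ) (s : V → Fin n → Bool) (x : V) :
    weightedMagnetization w (s x) =
      ∑ i, w i * spinAt (x, i) (fun b : V × Fin n => if s b.1 b.2 then (1 : ℤˣ) else -1) := by
  simp only [weightedMagnetization, spinAt_blockCfg]

/-- The nearest-neighbour term over ordered pairs:
`J ∑_{xy ∈ E(G)} τₓ τ_y = (J/2) ∑ₓ ∑_y [x ∼ y] τₓ τ_y` (weighted handshake,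
`sum_edgeFinset_eq_half_sum_neighborFinset`). [folklore] -/
theorem mul_pairInteraction_eq_half_sum_adj (J : ℝ) (τ : V → ℝ) :
    J * pairInteraction G τ = J / 2 * ∑ x, ∑ y, if G.Adj x y then τ x * τ y else 0 := by
  unfold pairInteraction
  rw [sum_edgeFinset_eq_half_sum_neighborFinset G, ← mul_assoc]
  simp only [Sym2.lift_mk]
  congr 1
  · ring
  · refine Finset.sum_congr rfl fun x _ => ?_
    rw [SimpleGraph.neighborFinset_eq_filter, Finset.sum_filter]

/-- **The block energy is a pair interaction on `V × Fin n`**: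
`∑ₓ ∑ᵢⱼ Kᵢⱼ s_{x,i}s_{x,j} + J ∑_{xy ∈ E(G)} τₓ(s)τ_y(s) = ∑_{a,b ∈ V × Fin n} c_{a,b} σ_a σ_b` with
`c_{(x,i),(y,j)} = [x = y] K_{ij} + [x ∼ y] (J/2) wᵢwⱼ` (Aizenman–Duminil-Copin 2021, §2, p. 7:
constituent Ising spins on the block graph). [cite: AizenmanDuminilCopinAnnals2021, §2, paragraph after Def. 2.1 (p. 7)] -/
theorem blockEnergy_eq_sum_coupling (K : Fin n → Fin n → ℝ) (w : Fin n → ℝ) (J : ℝ)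
    (s : V → Fin n → Bool) :
    ∑ x, isingPairEnergy K (s x) + J * pairInteraction G (fun x => weightedMagnetization w (s x)) =
      ∑ a : V × Fin n, ∑ b : V × Fin n,
        ((if a.1 = b.1 then K a.2 b.2 else (0 : ℝ)) +
            (if G.Adj a.1 b.1 then J / 2 * (w a.2 * w b.2) else 0)) *
          (spinAt a (fun b : V × Fin n => if s b.1 b.2 then (1 : ℤˣ) else -1) *
            spinAt b (fun b : V × Fin n => if s b.1 b.2 then (1 : ℤˣ) else -1)) := by
  set σ : SpinConfig (V × Fin n) := fun b : V × Fin n => if s b.1 b.2 then (1 : ℤˣ) else -1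
    with hσ_def
  have hσ : ∀ a : V × Fin n, spinAt a σ = spinVal (s a.1) a.2 := spinAt_blockCfg s
  simp only [add_mul, Finset.sum_add_distrib]
  congr 1
  · -- intra-block couplings
    rw [Fintype.sum_prod_type]
    refine Finset.sum_congr rfl fun x _ => ?_
    rw [isingPairEnergy]
    refine Finset.sum_congr rfl fun i _ => ?_
    rw [Fintype.sum_prod_type, Finset.sum_comm]
    refine Finset.sum_congr rfl fun j _ => ?_
    simp only [ite_mul, zero_mul, Finset.sum_ite_eq, Finset.mem_univ, if_true]
    rw [hσ, hσ]
    ring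
  · -- inter-block couplings along the edges of `G`
    have hτ : ∀ y : V, weightedMagnetization w (s y) = ∑ j, w j * spinAt (y, j) σ := fun y => by
      simp only [weightedMagnetization, hσ]
    rw [mul_pairInteraction_eq_half_sum_adj, Finset.mul_sum]
    simp only [Fintype.sum_prod_type]
    refine Finset.sum_congr rfl fun x _ => ?_
    rw [Finset.mul_sum, Finset.sum_comm]
    refine Finset.sum_congr rfl fun y _ => ?_
    by_cases hxy : G.Adj x y
    · simp only [hxy, if_true]
      rw [hτ, hτ, Finset.sum_mul_sum, Finset.mul_sum]
      refine Finset.sum_congr rfl fun i _ => ?_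
      rw [Finset.mul_sum]
      exact Finset.sum_congr rfl fun j _ => by ring
    · simp [hxy]

/-- **The block Gibbs sums are pair-interaction Ising averages on `V × Fin n`**: for any
observable `Φ` of the block variables,
`∑_s Φ(τ(s)) e^{−ℋ(s)} / ∑_s e^{−ℋ(s)} = ⟨Φ(τ)⟩_c` with `PairIsing.avg` of
`GaussianPairingBoundCouplings` and the block couplings `c`. [cite: AizenmanDuminilCopinAnnals2021, §2, Def. 2.1 (1) and the paragraph after it (p. 7)] -/
theorem blockGibbsSum_eq_avg (K : Fin n → Fin n → ℝ) (w : Fin n → ℝ) (J : ℝ) (Φ : (V → ℝ) → ℝ) :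
    (∑ s : V → Fin n → Bool, Φ (fun x => weightedMagnetization w (s x)) *
        Real.exp (∑ x, isingPairEnergy K (s x) +
          J * pairInteraction G (fun x => weightedMagnetization w (s x)))) /
      ∑ s : V → Fin n → Bool, Real.exp (∑ x, isingPairEnergy K (s x) +
          J * pairInteraction G (fun x => weightedMagnetization w (s x))) =
    PairIsing.avg (fun a b : V × Fin n => (if a.1 = b.1 then K a.2 b.2 else (0 : ℝ)) +
        (if G.Adj a.1 b.1 then J / 2 * (w a.2 * w b.2) else 0))
      (fun ρ => Φ (fun x => ∑ i, w i * spinAt (x, i) ρ)) := by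
  rw [PairIsing.avg_def]
  simp only [PairIsing.weight]
  have hτ : ∀ s : V → Fin n → Bool, (fun x => weightedMagnetization w (s x)) =
      fun x => ∑ i, w i * spinAt (x, i)
        (fun b : V × Fin n => if s b.1 b.2 then (1 : ℤˣ) else -1) := fun s =>
    funext fun x => weightedMagnetization_blockCfg w s x
  congr 1
  · rw [← sum_blockCfg]
    refine Finset.sum_congr rfl fun s _ => ?_
    rw [blockEnergy_eq_sum_coupling, hτ]
  · rw [← sum_blockCfg]
    refine Finset.sum_congr rfl fun s _ => ?_
    rw [blockEnergy_eq_sum_coupling]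

/-- **Expectations under the block-Ising lattice laws are pair-interaction Ising averages on
`V × Fin n`** (measurable observables): the composite of
`integral_latticeFieldMeasure_isingMagnetizationLaw` (`GriffithsSimonApproximation`) with
`blockGibbsSum_eq_avg`. This is the identification "we identify `⟨·⟩_{ρ,β}` with the Ising measure,
and `τₓ` with the proper average of Ising's variables" of Aizenman–Duminil-Copin 2021, §7 (p. 28),
at the level of the finite-`N` approximants. [cite: AizenmanDuminilCopinAnnals2021, §7 (p. 28) and §2 (p. 7)] -/
theorem integral_latticeFieldMeasure_isingMagnetizationLaw_eq_avg (K : Fin n → Fin n → ℝ)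
    (w : Fin n → ℝ) (J : ℝ) {F : (V → ℝ) → ℝ} (hF : Measurable F) :
    ∫ φ, F φ ∂(latticeFieldMeasure G (isingMagnetizationLaw n K w : Measure ℝ) J) =
      PairIsing.avg (fun a b : V × Fin n => (if a.1 = b.1 then K a.2 b.2 else (0 : ℝ)) +
          (if G.Adj a.1 b.1 then J / 2 * (w a.2 * w b.2) else 0))
        (fun ρ => F (fun x => ∑ i, w i * spinAt (x, i) ρ)) := by
  rw [integral_latticeFieldMeasure_isingMagnetizationLaw G K w J hF, blockGibbsSum_eq_avg]

omit [Fintype V] in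
/-- The block couplings are ferromagnetic when `K ≥ 0`, `w ≥ 0`, `J ≥ 0`. [folklore] -/
theorem blockCoupling_nonneg {K : Fin n → Fin n → ℝ} {w : Fin n → ℝ} {J : ℝ}
    (hK : ∀ i j, 0 ≤ K i j) (hw : ∀ i, 0 ≤ w i) (hJ : 0 ≤ J) (a b : V × Fin n) :
    0 ≤ (if a.1 = b.1 then K a.2 b.2 else (0 : ℝ)) +
      (if G.Adj a.1 b.1 then J / 2 * (w a.2 * w b.2) else 0) := by
  refine add_nonneg ?_ ?_
  · split_ifs
    · exact hK _ _
    · exact le_rfl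
  · split_ifs
    · exact mul_nonneg (div_nonneg hJ zero_le_two) (mul_nonneg (hw _) (hw _))
    · exact le_rfl

/-! ### Newman's Gaussian inequality: block approximants -/

omit [DecidableEq V] in
/-- The smeared block field is a nonnegatively weighted sum of constituent spins:
`∑ₓ aₓ τₓ = ∑_{(x,i)} (aₓ wᵢ) σ_{(x,i)}`. [folklore] -/
theorem sum_mul_blockVariable (a : V → ℝ) (w : Fin n → ℝ) (ρ : SpinConfig (V × Fin n)) :
    ∑ x, a x * ∑ i, w i * spinAt (x, i) ρ = ∑ b : V × Fin n, (a b.1 * w b.2) * spinAt b ρ := by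
  rw [Fintype.sum_prod_type]
  refine Finset.sum_congr rfl fun x _ => ?_
  rw [Finset.mul_sum]
  exact Finset.sum_congr rfl fun i _ => by ring

/-- **Newman's Gaussian inequality for the block-Ising lattice laws**: for `K ≥ 0`, `w ≥ 0`, `J ≥ 0`
and weights `a ≥ 0`, the smeared field `X = ∑ₓ aₓ φₓ` under
`latticeFieldMeasure G (isingMagnetizationLaw n K w) J` satisfies
`⟨X^{2m}⟩ ≤ (2m)!/(2^m m!) ⟨X²⟩^m` — the tree's `PairIsing.avg_pow_two_mul_le` (Newman 1975,
Thm 5, for pair-interaction Ising models on a finite set) applied on `V × Fin n` through the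
dictionary. [cite: Newman1975, Theorem 5, eq. (2.8)] -/
theorem blockIsing_integral_pow_le {K : Fin n → Fin n → ℝ} {w : Fin n → ℝ} {J : ℝ}
    (hK : ∀ i j, 0 ≤ K i j) (hw : ∀ i, 0 ≤ w i) (hJ : 0 ≤ J) (a : V → ℝ) (ha : ∀ x, 0 ≤ a x)
    (m : ℕ) :
    ∫ φ, (∑ x, a x * φ x) ^ (2 * m)
        ∂(latticeFieldMeasure G (isingMagnetizationLaw n K w : Measure ℝ) J) ≤
      ((2 * m).factorial : ℝ) / (2 ^ m * m.factorial) *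
        (∫ φ, (∑ x, a x * φ x) ^ 2
          ∂(latticeFieldMeasure G (isingMagnetizationLaw n K w : Measure ℝ) J)) ^ m := by
  rw [integral_latticeFieldMeasure_isingMagnetizationLaw_eq_avg G K w J (by fun_prop),
    integral_latticeFieldMeasure_isingMagnetizationLaw_eq_avg G K w J (by fun_prop)]
  simp only [sum_mul_blockVariable]
  exact PairIsing.avg_pow_two_mul_le _ (fun b b' _ => blockCoupling_nonneg G hK hw hJ b b') _
    (fun b => mul_nonneg (ha _) (hw _)) m

end Dictionary

/-! ### Exponential moments of the block approximants: `⟨e^{tX}⟩ ≤ e^{t²⟨X²⟩/2}` -/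

section MGF

variable {ι : Type*} [Fintype ι] [DecidableEq ι]

omit [Fintype ι] [DecidableEq ι] in
/-- The global spin flip negates each spin variable. [folklore] -/
theorem spinAt_neg (a : ι) (ρ : SpinConfig ι) : spinAt a (-ρ) = -spinAt a ρ := by
  simp [spinAt, Units.val_neg]

omit [DecidableEq ι] in
/-- The pair-interaction Boltzmann weight is invariant under the global spin flip (zero field).
[folklore] -/
theorem pairIsingWeight_neg (c : ι → ι → ℝ) (ρ : SpinConfig ι) :
    PairIsing.weight c (-ρ) = PairIsing.weight c ρ := by
  simp only [PairIsing.weight, spinAt_neg, mul_neg, neg_mul, neg_neg]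

/-- Odd observables have zero Gibbs average at zero field (spin-flip symmetry). [folklore] -/
theorem pairIsingAvg_eq_zero_of_odd (c : ι → ι → ℝ) {f : SpinConfig ι → ℝ}
    (hf : ∀ ρ, f (-ρ) = -f ρ) : PairIsing.avg c f = 0 := by
  rw [PairIsing.avg_def]
  have h : ∑ ρ, f ρ * PairIsing.weight c ρ = -∑ ρ, f ρ * PairIsing.weight c ρ :=
    calc ∑ ρ, f ρ * PairIsing.weight c ρ = ∑ ρ, f (-ρ) * PairIsing.weight c (-ρ) :=
          (Fintype.sum_equiv (Equiv.neg _) (fun ρ => f (-ρ) * PairIsing.weight c (-ρ))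
            (fun ρ => f ρ * PairIsing.weight c ρ) fun _ => rfl).symm
      _ = -∑ ρ, f ρ * PairIsing.weight c ρ := by
          simp only [hf, pairIsingWeight_neg, neg_mul, Finset.sum_neg_distrib]
  have h0 : ∑ ρ, f ρ * PairIsing.weight c ρ = 0 := by linarith
  rw [h0, zero_div]

/-- **Gaussian domination of the exponential moments** of `X = ∑_a g_a σ_a`, `g ≥ 0`, for the
pair-interaction Ising model with couplings `c ≥ 0` at zero field:
`⟨e^{tX}⟩ ≤ e^{t²⟨X²⟩/2}` for all real `t`. Summation of Newman's moment inequality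
`⟨X^{2m}⟩ ≤ (2m)!/(2^m m!) ⟨X²⟩^m` (`PairIsing.avg_pow_two_mul_le`) over the exponential series,
the odd moments vanishing by spin flip. [folklore] -/
theorem pairIsingAvg_exp_mul_le (c : ι → ι → ℝ) (hc : ∀ a b, a ≠ b → 0 ≤ c a b) (g : ι → ℝ)
    (hg : ∀ a, 0 ≤ g a) (t : ℝ) :
    PairIsing.avg c (fun ρ => Real.exp (t * ∑ a, g a * spinAt a ρ)) ≤
      Real.exp (t ^ 2 * PairIsing.avg c (fun ρ => (∑ a, g a * spinAt a ρ) ^ 2) / 2) := by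
  set X : SpinConfig ι → ℝ := fun ρ => ∑ a, g a * spinAt a ρ with hX
  set v : ℝ := PairIsing.avg c (fun ρ => X ρ ^ 2) with hv
  set F : ℕ → ℝ := fun k => t ^ k / k.factorial * PairIsing.avg c (fun ρ => X ρ ^ k) with hF
  -- (1) the exponential series, averaged: `HasSum F ⟨e^{tX}⟩`
  have hterm : ∀ k : ℕ, (∑ ρ, (t * X ρ) ^ k / k.factorial * PairIsing.weight c ρ) /
      (∑ ρ, PairIsing.weight c ρ) = F k := fun k => by
    rw [hF]
    simp only
    rw [PairIsing.avg_def, ← mul_div_assoc, Finset.mul_sum]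
    congr 1
    refine Finset.sum_congr rfl fun ρ _ => ?_
    rw [mul_pow]
    ring
  have h1 : HasSum F (PairIsing.avg c (fun ρ => Real.exp (t * X ρ))) := by
    have hρ : ∀ ρ : SpinConfig ι, HasSum (fun k : ℕ => (t * X ρ) ^ k / k.factorial *
        PairIsing.weight c ρ) (Real.exp (t * X ρ) * PairIsing.weight c ρ) := fun ρ => by
      have h := NormedSpace.expSeries_div_hasSum_exp (t * X ρ)
      rw [← Real.exp_eq_exp_ℝ] at h
      exact h.mul_right _
    have hsum := (hasSum_sum fun ρ (_ : ρ ∈ (Finset.univ : Finset (SpinConfig ι))) => hρ ρ).div_const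
      (∑ ρ, PairIsing.weight c ρ)
    have hfun : (fun k : ℕ => (∑ ρ, (t * X ρ) ^ k / k.factorial * PairIsing.weight c ρ) /
        ∑ ρ, PairIsing.weight c ρ) = F := funext hterm
    rw [hfun] at hsum
    rwa [PairIsing.avg_def]
  -- (2) odd moments vanish
  have hXneg : ∀ ρ, X (-ρ) = -X ρ := fun ρ => by
    simp only [hX, spinAt_neg, mul_neg, Finset.sum_neg_distrib]
  have hodd : ∀ m : ℕ, F (2 * m + 1) = 0 := fun m => by
    rw [hF]
    simp only
    rw [pairIsingAvg_eq_zero_of_odd c (fun ρ => ?_), mul_zero]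
    rw [hXneg, Odd.neg_pow ⟨m, rfl⟩]
  -- (3) even moments are Gaussian-dominated
  have heven : ∀ m : ℕ, F (2 * m) ≤ (t ^ 2 * v / 2) ^ m / m.factorial := fun m => by
    rw [hF]
    simp only
    have hmom := PairIsing.avg_pow_two_mul_le c hc g hg m
    have ht : 0 ≤ t ^ (2 * m) / ((2 * m).factorial : ℝ) := by
      rw [pow_mul]; positivity
    have hfac : ((2 * m).factorial : ℝ) ≠ 0 := by positivity
    calc t ^ (2 * m) / ((2 * m).factorial : ℝ) * PairIsing.avg c (fun ρ => X ρ ^ (2 * m))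
        ≤ t ^ (2 * m) / ((2 * m).factorial : ℝ) *
            (((2 * m).factorial : ℝ) / (2 ^ m * m.factorial) * v ^ m) :=
          mul_le_mul_of_nonneg_left hmom ht
      _ = (t ^ 2 * v / 2) ^ m / m.factorial := by
          rw [pow_mul, div_pow, mul_pow]
          field_simp
  -- (4) resummation
  have he : Summable fun m => F (2 * m) :=
    h1.summable.comp_injective (mul_right_injective₀ two_ne_zero)
  have ho : HasSum (fun m => F (2 * m + 1)) 0 := by
    simp only [hodd]
    exact hasSum_zero
  have htot : PairIsing.avg c (fun ρ => Real.exp (t * X ρ)) = ∑' m, F (2 * m) := by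
    rw [h1.unique (he.hasSum.even_add_odd ho), add_zero]
  have hexp : HasSum (fun m : ℕ => (t ^ 2 * v / 2) ^ m / m.factorial) (Real.exp (t ^ 2 * v / 2)) := by
    have h := NormedSpace.expSeries_div_hasSum_exp (t ^ 2 * v / 2)
    rwa [← Real.exp_eq_exp_ℝ] at h
  rw [htot]
  exact hasSum_le heven he.hasSum hexp

end MGF

/-! ### Newman's Gaussian inequality for the lattice `φ⁴` measure -/

section Phi4

variable {V : Type*} [Fintype V] (G : SimpleGraph V) [DecidableRel G.Adj]

/-- Growth of even powers of a smeared field: `|(∑ aₓφₓ)^{2p}| ≤ (∑ aₓ²)^p p! e^{∑ φₓ²}`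
(Cauchy–Schwarz and `t^p/p! ≤ e^t`), so that these observables are in the class handled by
`exists_blockIsing_tendsto_integral_phi4Measure`. [folklore] -/
theorem abs_pow_sum_mul_le (a : V → ℝ) (p : ℕ) (φ : V → ℝ) :
    |(∑ x, a x * φ x) ^ (2 * p)| ≤
      ((∑ x, a x ^ 2) ^ p * p.factorial) * Real.exp (1 * ∑ x, φ x ^ 2) := by
  set S : ℝ := ∑ x, φ x ^ 2 with hS
  set A : ℝ := ∑ x, a x ^ 2 with hA
  have hS0 : 0 ≤ S := Finset.sum_nonneg fun x _ => sq_nonneg _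
  have hA0 : 0 ≤ A := Finset.sum_nonneg fun x _ => sq_nonneg _
  have hcs : (∑ x, a x * φ x) ^ 2 ≤ A * S := Finset.sum_mul_sq_le_sq_mul_sq _ _ _
  have hSp : S ^ p ≤ p.factorial * Real.exp S := by
    have h := Real.pow_div_factorial_le_exp (hx := hS0) (n := p)
    rw [div_le_iff₀ (by positivity)] at h
    linarith
  rw [pow_mul, abs_of_nonneg (pow_nonneg (sq_nonneg _) _), one_mul]
  calc ((∑ x, a x * φ x) ^ 2) ^ p ≤ (A * S) ^ p := pow_le_pow_left₀ (sq_nonneg _) hcs p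
    _ = A ^ p * S ^ p := mul_pow _ _ _
    _ ≤ A ^ p * (p.factorial * Real.exp S) := mul_le_mul_of_nonneg_left hSp (pow_nonneg hA0 _)
    _ = A ^ p * p.factorial * Real.exp S := by ring

/-- **Newman's Gaussian inequality for the lattice `φ⁴` measure on a finite graph.** For `g > 0`,
real `κ`, `J ≥ 0` and weights `a ≥ 0`, the smeared field `X = ∑ₓ aₓ φₓ` under `phi4Measure G g κ J`
has Gaussian-dominated even moments,
`⟨X^{2m}⟩ ≤ (2m)!/(2^m m!) ⟨X²⟩^m = (2m − 1)!! ⟨X²⟩^m`.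
Newman 1975 proves this for the class of (limits of) ferromagnetic pair-interaction Ising systems
with Lee–Yang; here it is obtained along Aizenman–Duminil-Copin's route for the GS class (§7, p. 28:
Ising inequalities "extend to the GS class essentially by linearity, and then … by continuity"):
`blockIsing_integral_pow_le` for the block approximants of
`exists_blockIsing_tendsto_integral_phi4Measure` and passage to the limit. It is the smeared form of
the lower half `0 ≤ 𝒢_n[S] − S_{2n}` of ADC (6.3) for lattice `φ⁴`. [cite: Newman1975, Theorem 5, eq. (2.8); AizenmanDuminilCopinAnnals2021, §7 (p. 28) with §6.3 (6.3)] -/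
theorem phi4_integral_pow_le {g : ℝ} (hg : 0 < g) (κ : ℝ) {J : ℝ} (hJ : 0 ≤ J)
    (a : V → ℝ) (ha : ∀ x, 0 ≤ a x) (m : ℕ) :
    ∫ φ, (∑ x, a x * φ x) ^ (2 * m) ∂(phi4Measure G g κ J) ≤
      ((2 * m).factorial : ℝ) / (2 ^ m * m.factorial) *
        (∫ φ, (∑ x, a x * φ x) ^ 2 ∂(phi4Measure G g κ J)) ^ m := by
  classical
  obtain ⟨n, K, w, hK, hw, hlim⟩ := exists_blockIsing_tendsto_integral_phi4Measure G hg κ J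
  have h1 := hlim (fun φ => (∑ x, a x * φ x) ^ (2 * m)) (by fun_prop) _ _ (abs_pow_sum_mul_le a m)
  have h2 := hlim (fun φ => (∑ x, a x * φ x) ^ 2) (by fun_prop) _ _ (fun φ => by
    simpa only [mul_one] using abs_pow_sum_mul_le a 1 φ)
  exact le_of_tendsto_of_tendsto h1 ((h2.pow m).const_mul _)
    (Eventually.of_forall fun k => blockIsing_integral_pow_le G (hK k) (hw k) hJ a ha m)

/-- **Gaussian domination of the exponential moments of the lattice `φ⁴` field** (finite graph): for
`g > 0`, real `κ`, `J ≥ 0`, weights `a ≥ 0` and all real `t`,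
`⟨e^{t ∑ aₓφₓ}⟩ ≤ exp(t² ⟨(∑ aₓφₓ)²⟩ / 2)` under `phi4Measure G g κ J` — `pairIsingAvg_exp_mul_le`
for the block approximants and passage to the limit (`e^{tX}` is in the admissible growth class:
`tX ≤ t²/2 + X²/2 ≤ t²/2 + (∑ aₓ²)(∑ φₓ²)/2`). This is the a-priori exponential-moment bound
through which uniform second-moment bounds give uniform exponential integrability of smeared
lattice `φ⁴` fields. [folklore] -/
theorem phi4_integral_exp_mul_le {g : ℝ} (hg : 0 < g) (κ : ℝ) {J : ℝ} (hJ : 0 ≤ J)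
    (a : V → ℝ) (ha : ∀ x, 0 ≤ a x) (t : ℝ) :
    ∫ φ, Real.exp (t * ∑ x, a x * φ x) ∂(phi4Measure G g κ J) ≤
      Real.exp (t ^ 2 * (∫ φ, (∑ x, a x * φ x) ^ 2 ∂(phi4Measure G g κ J)) / 2) := by
  classical
  obtain ⟨n, K, w, hK, hw, hlim⟩ := exists_blockIsing_tendsto_integral_phi4Measure G hg κ J
  have h1 := hlim (fun φ => Real.exp (t * ∑ x, a x * φ x)) (by fun_prop) (Real.exp (t ^ 2 / 2))
    ((∑ x, a x ^ 2) / 2) (fun φ => by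
      rw [abs_of_pos (Real.exp_pos _), ← Real.exp_add, Real.exp_le_exp]
      have hcs : (∑ x, a x * φ x) ^ 2 ≤ (∑ x, a x ^ 2) * ∑ x, φ x ^ 2 :=
        Finset.sum_mul_sq_le_sq_mul_sq _ _ _
      nlinarith [sq_nonneg (t - ∑ x, a x * φ x)])
  have h2 := hlim (fun φ => (∑ x, a x * φ x) ^ 2) (by fun_prop) _ _ (fun φ => by
    simpa only [mul_one] using abs_pow_sum_mul_le a 1 φ)
  have h2' := (Real.continuous_exp.tendsto _).comp ((h2.const_mul (t ^ 2)).div_const 2)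
  refine le_of_tendsto_of_tendsto h1 h2' (Eventually.of_forall fun k => ?_)
  simp only [Function.comp_apply]
  rw [integral_latticeFieldMeasure_isingMagnetizationLaw_eq_avg G (K k) (w k) J (by fun_prop),
    integral_latticeFieldMeasure_isingMagnetizationLaw_eq_avg G (K k) (w k) J (by fun_prop)]
  simp only [sum_mul_blockVariable]
  exact pairIsingAvg_exp_mul_le _ (fun b b' _ => blockCoupling_nonneg G (hK k) (hw k) hJ b b') _
    (fun b => mul_nonneg (ha _) (hw k _)) t

end Phi4

/-! ### The site form: `S_{2n}(x) ≤ 𝒢_n[S₂](x)` (multilinearity of the pairing functional) -/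

section SiteVersion

variable {α β : Type*} [Fintype β]

omit [Fintype β] in
/-- Regrouping a product over `Fin (2n)` by the pairs of an ordering `τ`. [folklore] -/
theorem prod_eq_prod_pairIdx {n : ℕ} (f : Fin (2 * n) → ℝ) (τ : Equiv.Perm (Fin (2 * n))) :
    ∏ i, f i = ∏ j : Fin n, f (τ (pairIdx n (j, 0))) * f (τ (pairIdx n (j, 1))) := by
  rw [← Equiv.prod_comp τ f, ← Equiv.prod_comp (pairIdx n) (fun i => f (τ i)),
    Fintype.prod_prod_type]
  simp only [Fin.prod_univ_two]

/-- For a fixed ordering `τ`, summing the weights `∏ᵢ w(Lᵢ)` against a product over the pairs of `τ`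
factorises pair by pair. [folklore] -/
theorem sum_prod_mul_prod_pairs_eq {n : ℕ} (w : β → ℝ) (T : Fin n → β → β → ℝ)
    (τ : Equiv.Perm (Fin (2 * n))) :
    ∑ L : Fin (2 * n) → β, (∏ i, w (L i)) *
        ∏ j : Fin n, T j (L (τ (pairIdx n (j, 0)))) (L (τ (pairIdx n (j, 1)))) =
      ∏ j : Fin n, ∑ l, ∑ l', w l * w l' * T j l l' := by
  classical
  set F : Fin n → β × β → ℝ := fun j p => w p.1 * w p.2 * T j p.1 p.2 with hF
  have hre : ∀ L : Fin (2 * n) → β, (∏ i, w (L i)) *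
      ∏ j : Fin n, T j (L (τ (pairIdx n (j, 0)))) (L (τ (pairIdx n (j, 1)))) =
      ∏ j : Fin n, F j (pairSplit β n (L ∘ τ) j) := fun L => by
    rw [prod_eq_prod_pairIdx (fun i => w (L i)) τ, ← Finset.prod_mul_distrib]
    refine Finset.prod_congr rfl fun j _ => ?_
    simp only [hF, pairSplit_apply, Function.comp_apply]
  have hsum : ∑ L : Fin (2 * n) → β, ∏ j : Fin n, F j (pairSplit β n (L ∘ τ) j) =
      ∑ M : Fin n → β × β, ∏ j : Fin n, F j (M j) :=
    Fintype.sum_equiv ((Equiv.arrowCongr τ.symm (Equiv.refl β)).trans (pairSplit β n))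
      (fun L => ∏ j : Fin n, F j (pairSplit β n (L ∘ τ) j)) (fun M => ∏ j : Fin n, F j (M j))
      (fun L => rfl)
  have hprod : ∏ j : Fin n, ∑ l, ∑ l', w l * w l' * T j l l' = ∏ j : Fin n, ∑ p : β × β, F j p :=
    Finset.prod_congr rfl fun j _ => by simp only [hF, Fintype.sum_prod_type]
  simp_rw [hre]
  rw [hsum, hprod, Fintype.prod_sum]

/-- **Multilinearity of the Gaussian pairing functional in the points.** For block variables
`τ_a = ∑_l w_l σ_{(a,l)}`: smearing `𝒢_n[S]` over the constituent indices with the weights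
`∏ᵢ w(Lᵢ)` gives `𝒢_n` of the smeared two-point function,
`∑_L (∏ᵢ w_{Lᵢ}) 𝒢_n[S]((x₁,L₁),…,(x_{2n},L_{2n})) = 𝒢_n[S^τ](x)`,
`S^τ(a,a') = ∑_{l,l'} w_l w_{l'} S((a,l),(a',l'))` ("by linearity", Aizenman–Duminil-Copin 2021, §7,
p. 28). [cite: AizenmanDuminilCopinAnnals2021, §7 (p. 28, first paragraph)] -/
theorem sum_prod_mul_pairingSum_eq {n : ℕ} (S : α × β → α × β → ℝ) (w : β → ℝ)
    (x : Fin (2 * n) → α) :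
    ∑ L : Fin (2 * n) → β, (∏ i, w (L i)) * pairingSum S n (fun i => (x i, L i)) =
      pairingSum (fun a a' => ∑ l, ∑ l', w l * w l' * S (a, l) (a', l')) n x := by
  classical
  unfold pairingSum
  have hL : ∀ L : Fin (2 * n) → β, (∏ i, w (L i)) * (((2 : ℝ) ^ n * n.factorial)⁻¹ *
      ∑ τ : Equiv.Perm (Fin (2 * n)), ∏ j : Fin n,
        S (x (τ (pairIdx n (j, 0))), L (τ (pairIdx n (j, 0))))
          (x (τ (pairIdx n (j, 1))), L (τ (pairIdx n (j, 1))))) =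
      ((2 : ℝ) ^ n * n.factorial)⁻¹ * ∑ τ : Equiv.Perm (Fin (2 * n)), (∏ i, w (L i)) *
        ∏ j : Fin n, S (x (τ (pairIdx n (j, 0))), L (τ (pairIdx n (j, 0))))
          (x (τ (pairIdx n (j, 1))), L (τ (pairIdx n (j, 1)))) := fun L => by
    rw [mul_left_comm, Finset.mul_sum]
  simp_rw [hL]
  rw [← Finset.mul_sum, Finset.sum_comm]
  congr 1
  refine Finset.sum_congr rfl fun τ _ => ?_
  exact sum_prod_mul_prod_pairs_eq w
    (fun j l l' => S (x (τ (pairIdx n (j, 0))), l) (x (τ (pairIdx n (j, 1))), l')) τ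

end SiteVersion

section SitePhi4

variable {V : Type*} [Fintype V] [DecidableEq V] (G : SimpleGraph V) [DecidableRel G.Adj] {n : ℕ}

/-- **The Gaussian (Newman–Aizenman) inequality for the block-Ising lattice laws, site form**:
for `K ≥ 0`, `w ≥ 0`, `J ≥ 0` and points `x₁, …, x_{2m}`,
`⟨φ_{x₁} ⋯ φ_{x_{2m}}⟩ ≤ 𝒢_m[⟨φφ⟩](x)` under `latticeFieldMeasure G (isingMagnetizationLaw n K w) J`:
the pairing bound `PairIsing.avg_spinMonomial_le_pairingSum` for the constituent spins on
`V × Fin n`, smeared over the blocks (`sum_prod_mul_pairingSum_eq`). This is the lower half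
`S_{2n} ≤ 𝒢_n[S]` of Aizenman–Duminil-Copin 2021, (6.3), for the block approximants of the GS class
(§7, p. 28). [cite: AizenmanDuminilCopinAnnals2021, §6.3 (6.3) with §7 (p. 28)] -/
theorem blockIsing_integral_prod_le_pairingSum {K : Fin n → Fin n → ℝ} {w : Fin n → ℝ} {J : ℝ}
    (hK : ∀ i j, 0 ≤ K i j) (hw : ∀ i, 0 ≤ w i) (hJ : 0 ≤ J) (m : ℕ) (x : Fin (2 * m) → V) :
    ∫ φ, ∏ i, φ (x i) ∂(latticeFieldMeasure G (isingMagnetizationLaw n K w : Measure ℝ) J) ≤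
      pairingSum (fun a b => ∫ φ, φ a * φ b
        ∂(latticeFieldMeasure G (isingMagnetizationLaw n K w : Measure ℝ) J)) m x := by
  classical
  set c : V × Fin n → V × Fin n → ℝ := fun a b => (if a.1 = b.1 then K a.2 b.2 else (0 : ℝ)) +
    (if G.Adj a.1 b.1 then J / 2 * (w a.2 * w b.2) else 0) with hc_def
  have hc : ∀ a b : V × Fin n, a ≠ b → 0 ≤ c a b := fun a b _ => blockCoupling_nonneg G hK hw hJ a b
  set S₂ : V × Fin n → V × Fin n → ℝ := fun p q => PairIsing.avg c (spinPair p q) with hS₂_def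
  -- the two-point function of the blocks in terms of the constituent spins
  have h2 : (fun a b => ∫ φ, φ a * φ b
      ∂(latticeFieldMeasure G (isingMagnetizationLaw n K w : Measure ℝ) J)) =
      fun a b => ∑ l, ∑ l', w l * w l' * S₂ (a, l) (b, l') := by
    funext a b
    rw [integral_latticeFieldMeasure_isingMagnetizationLaw_eq_avg G K w J (by fun_prop)]
    have hexp : ∀ ρ : SpinConfig (V × Fin n),
        (∑ i, w i * spinAt (a, i) ρ) * ∑ i, w i * spinAt (b, i) ρ =
          ∑ l, ∑ l', w l * w l' * spinPair (a, l) (b, l') ρ := fun ρ => by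
      rw [Finset.sum_mul_sum]
      refine Finset.sum_congr rfl fun l _ => Finset.sum_congr rfl fun l' _ => ?_
      rw [spinPair]
      ring
    simp_rw [hexp]
    rw [PairIsing.avg_finset_sum]
    refine Finset.sum_congr rfl fun l _ => ?_
    rw [PairIsing.avg_finset_sum]
    exact Finset.sum_congr rfl fun l' _ => PairIsing.avg_const_mul c _ _
  -- the `2m`-point function of the blocks in terms of the constituent spins
  have hprod : ∀ ρ : SpinConfig (V × Fin n), ∏ i, ∑ l, w l * spinAt (x i, l) ρ =
      ∑ L : Fin (2 * m) → Fin n, (∏ i, w (L i)) * spinMonomial (fun i => (x i, L i)) ρ := fun ρ => by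
    rw [Fintype.prod_sum]
    refine Finset.sum_congr rfl fun L _ => ?_
    rw [spinMonomial, ← Finset.prod_mul_distrib]
  rw [integral_latticeFieldMeasure_isingMagnetizationLaw_eq_avg G K w J (by fun_prop), h2,
    ← sum_prod_mul_pairingSum_eq S₂ w x]
  simp_rw [hprod]
  rw [PairIsing.avg_finset_sum]
  refine Finset.sum_le_sum fun L _ => ?_
  rw [PairIsing.avg_const_mul]
  exact mul_le_mul_of_nonneg_left (PairIsing.avg_spinMonomial_le_pairingSum c hc m _)
    (Finset.prod_nonneg fun i _ => hw _)

omit [DecidableEq V] in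
/-- Growth of field monomials: `|∏ᵢ φ_{xᵢ}| ≤ e^{m ∑ₓ φₓ²}` for `2m` factors (`|t| ≤ e^{t²/2}` and
`φ_y² ≤ ∑ₓ φₓ²`). [folklore] -/
theorem abs_prod_apply_le (m : ℕ) (x : Fin (2 * m) → V) (φ : V → ℝ) :
    |∏ i, φ (x i)| ≤ 1 * Real.exp (m * ∑ y, φ y ^ 2) := by
  have hle : ∀ t : ℝ, |t| ≤ Real.exp (t ^ 2 / 2) := fun t => by
    have h1 : |t| ≤ 1 + t ^ 2 / 2 := by
      rcases le_or_gt 0 t with ht | ht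
      · rw [abs_of_nonneg ht]; nlinarith [sq_nonneg (t - 1)]
      · rw [abs_of_neg ht]; nlinarith [sq_nonneg (t + 1)]
    exact h1.trans (by linarith [Real.add_one_le_exp (t ^ 2 / 2)])
  have hS : ∀ i, φ (x i) ^ 2 ≤ ∑ y, φ y ^ 2 := fun i =>
    Finset.single_le_sum (fun y _ => sq_nonneg (φ y)) (Finset.mem_univ (x i))
  rw [one_mul, Finset.abs_prod]
  calc ∏ i, |φ (x i)| ≤ ∏ i : Fin (2 * m), Real.exp (φ (x i) ^ 2 / 2) :=
        Finset.prod_le_prod (fun i _ => abs_nonneg _) fun i _ => hle _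
    _ = Real.exp (∑ i : Fin (2 * m), φ (x i) ^ 2 / 2) := (Real.exp_sum _ _).symm
    _ ≤ Real.exp (m * ∑ y, φ y ^ 2) := by
        refine Real.exp_le_exp.mpr ?_
        calc ∑ i : Fin (2 * m), φ (x i) ^ 2 / 2 ≤ ∑ _i : Fin (2 * m), (∑ y, φ y ^ 2) / 2 :=
              Finset.sum_le_sum fun i _ => by linarith [hS i]
          _ = m * ∑ y, φ y ^ 2 := by
              rw [Finset.sum_const, Finset.card_univ, Fintype.card_fin, nsmul_eq_mul]
              push_cast
              ring

omit [DecidableEq V] in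
/-- **The Gaussian (Newman–Aizenman) inequality for the lattice `φ⁴` measure, site form.** For
`g > 0`, real `κ`, `J ≥ 0` and points `x₁, …, x_{2m}` of a finite graph,
`⟨φ_{x₁} ⋯ φ_{x_{2m}}⟩ ≤ 𝒢_m[⟨φφ⟩](x₁,…,x_{2m})` under `phi4Measure G g κ J`, `𝒢_m` the Gaussian
pairing functional (`pairingSum`) of the two-point function: the lower half `S_{2n} ≤ 𝒢_n[S]` of
Aizenman–Duminil-Copin 2021, eq. (6.3) ("derived using the switching lemma in [Aiz82]") for the
lattice `φ⁴` member of the GS class, obtained as in §7 (p. 28) from the block approximants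
(`blockIsing_integral_prod_le_pairingSum`, `tendsto_pairingSum`,
`exists_blockIsing_tendsto_integral_phi4Measure`). For `m = 2` this is Lebowitz' inequality
`U₄ ≤ 0`. [cite: AizenmanDuminilCopinAnnals2021, §6.3 (6.3), lower inequality (p. 26), with §7 (p. 28)] -/
theorem phi4_integral_prod_le_pairingSum {g : ℝ} (hg : 0 < g) (κ : ℝ) {J : ℝ} (hJ : 0 ≤ J)
    (m : ℕ) (x : Fin (2 * m) → V) :
    ∫ φ, ∏ i, φ (x i) ∂(phi4Measure G g κ J) ≤
      pairingSum (fun a b => ∫ φ, φ a * φ b ∂(phi4Measure G g κ J)) m x := by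
  classical
  obtain ⟨n, K, w, hK, hw, hlim⟩ := exists_blockIsing_tendsto_integral_phi4Measure G hg κ J
  have h1 := hlim (fun φ => ∏ i, φ (x i)) (by fun_prop) _ _ (abs_prod_apply_le m x)
  have h2 : ∀ a b : V, Tendsto (fun k => ∫ φ, φ a * φ b
      ∂(latticeFieldMeasure G (isingMagnetizationLaw (n k) (K k) (w k) : Measure ℝ) J)) atTop
      (𝓝 (∫ φ, φ a * φ b ∂(phi4Measure G g κ J))) := fun a b =>
    hlim (fun φ => φ a * φ b) (by fun_prop) 1 1 (fun φ => by
      have ha := Finset.single_le_sum (fun y _ => sq_nonneg (φ y)) (Finset.mem_univ a)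
      have hb := Finset.single_le_sum (fun y _ => sq_nonneg (φ y)) (Finset.mem_univ b)
      rw [abs_mul, one_mul, one_mul]
      nlinarith [abs_nonneg (φ a), abs_nonneg (φ b), sq_abs (φ a), sq_abs (φ b),
        Real.add_one_le_exp (∑ y, φ y ^ 2), sq_nonneg (|φ a| - |φ b|)])
  exact le_of_tendsto_of_tendsto h1 (tendsto_pairingSum h2 m x)
    (Eventually.of_forall fun k => blockIsing_integral_prod_le_pairingSum G (hK k) (hw k) hJ m x)

end SitePhi4

end Literature.MathematicalPhysics.QuantumLattice

end
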